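import Summits.QuantumFields.BalabanUV.Beta.ResolventLeafRecord
import Summits.QuantumFields.BalabanUV.Beta.ResolventBoxCertificateTaylor

/-!
# Beta / ResolventResidualBlocks — THE BLOCKS OF THE INVERSE FROM RESIDUAL DATA: `‖1 − P·A‖ ≤ θ < 1 ⟹ A⁻¹ = P + X·P`, `‖X‖ ≤ θ∕(1−θ)`, hence
# `‖(A⁻¹)_{IJ}‖ ≤ ‖P_{IJ}‖ + θ∕(1−θ)·‖P_{·J}‖`; the block-currency leaf with `hG` DISCHARGED and its four sups DERIVED from residual data
# (β sub-cell, BINDER-OWNERS row CAP-k, lineage `b2b-balaban-beta-an5`, gen 27; node BETA-an5-g27-COEFF, leaf 2; cap4-g19's (BLK) of journal l.19578)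

WHY.  cap4-g19's DBLOCK run (INTENT-UPDATE (3) l.19578, jobs j104319∕j104320) certifies, per sub-leaf of the worst-corner box, the residual record
`(θ, p, B)` AND exact bounds of the four blocks of `k_sc(q)⁻¹` in the split `v ⊕ w` (bond variables ⊕ averaging multipliers) «by the elementary
identity (BLK): `E := 1 − P k`, `‖E‖ ≤ θ < 1 ⇒ k⁻¹ = (1−E)⁻¹P = P + E(1−E)⁻¹P ⇒ ‖(k⁻¹)_{IJ}‖ ≤ sup‖P_{IJ}‖ + θ∕(1−θ)·sup‖P_{·J}‖`», to be assembled
into ONE `ResolventLeafRecord.BlockLeafRecord` whose closed-form hypothesis `hG` is met by the blocks of `(A q)⁻¹` itself.  This module puts both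
steps in the kernel:
* §1 SUB-BLOCKS DO NOT INCREASE THE EUCLIDEAN OPERATOR NORM: `‖M.submatrix f g‖ ≤ ‖M‖` for injective `f`, `g` (`l2_opNorm_submatrix_le`; rows by
  restriction of the image vector, columns by `ᴴ`).
* §2 (BLK) IN THE KERNEL: `‖1 − P·A‖ ≤ θ < 1 ⟹ ∃ X, ‖X‖ ≤ θ∕(1−θ) ∧ A⁻¹ = P + X·P` (`inv_eq_precond_add`, `X = (1 − PA)(PA)⁻¹`), and for a split
  `e : v ⊕ w ≃ n`, an injective row selector `r` and any column selector `s`: `‖((A⁻¹).submatrix e e).submatrix r s‖ ≤ ‖P′.submatrix r s‖ + θ∕(1−θ)·‖P′.submatrix id s‖`,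
  `P′ = P.submatrix e e` (`norm_invBlock_le`, `norm_invBlock_le_of_sups`) — cap4's (BLK) literally, block by block; the four `toBlocks` as
  `submatrix` selections (`toBlocksᵢⱼ_eq_submatrix`, `rfl`).
* §3 **`box_certificate_of_invBlocks`** — the block-currency leaf of p223026∕p223404 with `hG` DISCHARGED: `IsUnit (A q).det` on the box + sups of
  the four blocks of `((A q)⁻¹).submatrix e e` + the norm2x2 criterion ⟹ `‖(A q)⁻¹‖ ≤ B` (cap4's «third representation»: G X Y Z := the blocks of the
  inverse itself); **`box_certificate_of_residualBlocks`** — the hG-FREE BLOCK LEAF FROM RESIDUAL DATA: `‖1 − P q·A q‖ ≤ θ < 1` on the box, sups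
  `p₁₁ p₁₂ p₂₁ p₂₂` of the four blocks of `P′` and `s₁ s₂` of its two column blocks, `a ≥ p₁₁ + θ∕(1−θ)·s₁`, `b ≥ p₁₂ + θ∕(1−θ)·s₂`, `c′ ≥ p₂₁ +
  θ∕(1−θ)·s₁`, `e′ ≥ p₂₂ + θ∕(1−θ)·s₂` and the sqrt-free norm2x2 criterion for `B` ⟹ `IsUnit (A q).det ∧ ‖(A q)⁻¹‖ ≤ B` on the box — the per-leaf
  conclusion every route-A anchor consumes (`ResolventBoxCertificate.of_cover`, `hcert_of_…`).
* §4 **`ResidualBlockLeafRecord`** — the numeric content of §3 as a kernel structure over `ℚ` `(cRe, cIm, h, θ, p₁₁, p₁₂, p₂₁, p₂₂, s₁, s₂, B)` with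
  DECIDABLE `Valid` (θ < 1, 0 ≤ B, the criterion on the derived `a b c′ e′`), `certifies`, **`hcert_of_residualBlockRecords`** (the binder `hcert` of
  `ResolventLeafRecord.rowsOfOneLoopFormCode16E_routeA₂_ofSchedulesQ` from one record per kernel leaf + per record the residual sup and six
  P-block sups — NO closed form, NO `hG`).

WHY IT IS SHARPER THAN THE PLAIN RESIDUAL LEAF (cap4's forecast l.19578, NOT asserted here): on the worst-corner box the resolvent norm lives in the
4 × 4 multiplier block (`‖k⁻¹‖ ≈ 318` with blocks ≈ 55 ∕ 55 ∕ 46 ∕ 314), so the norm2x2 assembly of block bounds (`B_min(block) ≈ 355`) beats the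
scalar residual budget (`414.83`); the kernel now derives the block bounds from the SAME residual run's `θ` and the preconditioner's blocks.

v1.0.1 (DOCFIX, XREAD C-ne9leaf04g30-1 DOCFIX-LOW-1): the refuting example's gloss corrected (`b ≈ 64.47`, not `62.6`); declarations byte-identical.

HONEST FRAMING.  Kernel glue ([folklore] Neumann-series block algebra); no box, no preconditioner, no number supplied; 0 binders of the real row
instantiated; 0 certified coefficients; discharging `BetaPertH` would make Bałaban's ultraviolet stability UNCONDITIONAL — NOT the continuum limit,
NOT the Clay problem.  HONEST DEPENDENCY: continuum YM on T⁴ ⇐ BetaPertH ∧ nine spine estimates (0∕9 proved); BetaPertH ⇐ (D1) ∧ (D4) ∧ CAP+tail;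
G-an2-4 gates asym, D1 and NE2∕3∕4.  0 `sorry`, 0 cite tags.
-/

namespace Summit.QuantumFields.BalabanUV.Beta.ResolventBoxCertificate

open Complex Set Matrix Finset WithLp
open Summit.QuantumFields.BalabanUV.Beta.GAN24.ArrowNorms (l2_opNorm_le_of_forall norm_le_of_sq_le)
open scoped Real Matrix.Norms.L2Operator

noncomputable section

/-! ## §1 Sub-blocks do not increase the Euclidean operator norm -/

section SubBlocks

variable {m o m' o' : Type*} [Fintype m] [Fintype o] [Fintype m'] [Fintype o']
  [DecidableEq m] [DecidableEq o] [DecidableEq m'] [DecidableEq o']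

omit [Fintype o] [Fintype o'] [DecidableEq o] [DecidableEq m'] [DecidableEq o'] in
/-- restricting a vector to an injectively indexed sub-family does not increase its Euclidean norm. [folklore] -/
theorem norm_toLp_comp_le_of_injective {f : m' → m} (hf : Function.Injective f) (y : m → ℂ) :
    ‖(toLp 2 (y ∘ f) : EuclideanSpace ℂ m')‖ ≤ ‖(toLp 2 y : EuclideanSpace ℂ m)‖ := by
  refine norm_le_of_sq_le _ (norm_nonneg _) ?_
  rw [EuclideanSpace.norm_sq_eq, EuclideanSpace.norm_sq_eq]
  simp only [Function.comp_apply]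
  calc ∑ i, ‖y (f i)‖ ^ 2 = ∑ j ∈ Finset.univ.image f, ‖y j‖ ^ 2 := by
        rw [Finset.sum_image fun i _ j _ h => hf h]
    _ ≤ ∑ j, ‖y j‖ ^ 2 := Finset.sum_le_sum_of_subset_of_nonneg (Finset.subset_univ _) fun j _ _ => sq_nonneg _

omit [Fintype o'] [DecidableEq m'] [DecidableEq o'] in
/-- ROW SELECTION: `‖M.submatrix f id‖ ≤ ‖M‖` for injective `f`. [folklore] -/
theorem l2_opNorm_submatrix_rows_le (M : Matrix m o ℂ) {f : m' → m} (hf : Function.Injective f) : ‖M.submatrix f id‖ ≤ ‖M‖ := by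
  refine l2_opNorm_le_of_forall _ (norm_nonneg _) fun x => ?_
  have e : M.submatrix f id *ᵥ ofLp x = (M *ᵥ ofLp x) ∘ f := by
    funext i; rfl
  rw [e]
  calc ‖(toLp 2 ((M *ᵥ ofLp x) ∘ f) : EuclideanSpace ℂ m')‖ ≤ ‖(toLp 2 (M *ᵥ ofLp x) : EuclideanSpace ℂ m)‖ :=
        norm_toLp_comp_le_of_injective hf _
    _ ≤ ‖M‖ * ‖x‖ := by simpa using Matrix.l2_opNorm_mulVec M x

omit [Fintype m'] [DecidableEq m'] in
/-- COLUMN SELECTION: `‖M.submatrix id g‖ ≤ ‖M‖` for injective `g` (by `ᴴ`). [folklore] -/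
theorem l2_opNorm_submatrix_cols_le (M : Matrix m o ℂ) {g : o' → o} (hg : Function.Injective g) : ‖M.submatrix id g‖ ≤ ‖M‖ := by
  rw [← Matrix.l2_opNorm_conjTranspose (M.submatrix id g), Matrix.conjTranspose_submatrix, ← Matrix.l2_opNorm_conjTranspose M]
  exact l2_opNorm_submatrix_rows_le _ hg

/-- **SUB-BLOCKS DO NOT INCREASE THE NORM**: `‖M.submatrix f g‖ ≤ ‖M‖` for injective `f`, `g`. [folklore] -/
theorem l2_opNorm_submatrix_le (M : Matrix m o ℂ) {f : m' → m} {g : o' → o} (hf : Function.Injective f) (hg : Function.Injective g) :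
    ‖M.submatrix f g‖ ≤ ‖M‖ := by
  have e : M.submatrix f g = (M.submatrix f id).submatrix id g := by rw [Matrix.submatrix_submatrix]; rfl
  rw [e]
  exact (l2_opNorm_submatrix_cols_le _ hg).trans (l2_opNorm_submatrix_rows_le _ hf)

end SubBlocks

/-! ## §2 (BLK): the inverse from residual data, block by block -/

section BLK

variable {n v w : Type*} [Fintype n] [Fintype v] [Fintype w] [DecidableEq n] [DecidableEq v] [DecidableEq w]

omit [DecidableEq n] in
/-- `‖1‖ ≤ 1` in the Euclidean operator norm (also for the empty index type). [folklore] -/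
private theorem norm_one_le' [DecidableEq n] : ‖(1 : Matrix n n ℂ)‖ ≤ 1 := by
  rw [← diagonal_one, l2_opNorm_diagonal]
  exact (pi_norm_le_iff_of_nonneg zero_le_one).mpr fun _ => by simp

/-- **(BLK), GLOBAL FORM**: `‖1 − P·A‖ ≤ θ < 1 ⟹ A⁻¹ = P + X·P` with `X = (1 − PA)(PA)⁻¹`, `‖X‖ ≤ θ∕(1−θ)` (and `A` is invertible). [folklore] -/
theorem inv_eq_precond_add {A P : Matrix n n ℂ} {θ : ℝ} (hres : ‖1 - P * A‖ ≤ θ) (hθ1 : θ < 1) :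
    IsUnit A.det ∧ ∃ X : Matrix n n ℂ, ‖X‖ ≤ θ / (1 - θ) ∧ A⁻¹ = P + X * P := by
  obtain ⟨hT, hTinv⟩ := norm_inv_le_of_norm_one_sub_le hres hθ1
  obtain ⟨hA, -⟩ := krawczyk hres hθ1
  refine ⟨hA, (1 - P * A) * (P * A)⁻¹, ?_, ?_⟩
  · have h1θ : 0 < 1 - θ := by linarith
    have hθ0 : 0 ≤ θ := (norm_nonneg _).trans hres
    calc ‖(1 - P * A) * (P * A)⁻¹‖ ≤ ‖1 - P * A‖ * ‖(P * A)⁻¹‖ := l2_opNorm_mul _ _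
      _ ≤ θ * (1 / (1 - θ)) := mul_le_mul hres hTinv (norm_nonneg _) hθ0
      _ = θ / (1 - θ) := by ring
  · -- `A⁻¹ = (PA)⁻¹ P` and `(PA)⁻¹ = 1 + (1 − PA)(PA)⁻¹`
    have e1 : A⁻¹ = (P * A)⁻¹ * P := by
      have h1 : (P * A)⁻¹ * P * A = 1 := by rw [Matrix.mul_assoc, Matrix.nonsing_inv_mul _ hT]
      exact Matrix.inv_eq_left_inv h1
    have e2 : (P * A)⁻¹ = 1 + (1 - P * A) * (P * A)⁻¹ := by
      rw [Matrix.sub_mul, Matrix.one_mul, Matrix.mul_nonsing_inv _ hT]; abel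
    rw [e1]
    conv_lhs => rw [e2]
    rw [Matrix.add_mul, Matrix.one_mul]

/-- **(BLK), BLOCK BY BLOCK** (cap4-g19 l.19578 literally): for a split `e : v ⊕ w ≃ n`, an injective row selector `r` and any column selector `s`
of the split index, `‖((A⁻¹).submatrix e e).submatrix r s‖ ≤ ‖(P.submatrix e e).submatrix r s‖ + θ∕(1−θ) · ‖(P.submatrix e e).submatrix id s‖`. [folklore] -/
theorem norm_invBlock_le {A P : Matrix n n ℂ} {θ : ℝ} (hres : ‖1 - P * A‖ ≤ θ) (hθ1 : θ < 1) (e : v ⊕ w ≃ n)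
    {α β : Type*} [Fintype α] [Fintype β] [DecidableEq α] [DecidableEq β]
    {r : α → v ⊕ w} (hr : Function.Injective r) (s : β → v ⊕ w) :
    ‖((A⁻¹).submatrix e e).submatrix r s‖
      ≤ ‖(P.submatrix e e).submatrix r s‖ + θ / (1 - θ) * ‖(P.submatrix e e).submatrix id s‖ := by
  obtain ⟨-, X, hX, hinv⟩ := inv_eq_precond_add hres hθ1
  have e1 : ((A⁻¹).submatrix e e).submatrix r s
      = (P.submatrix e e).submatrix r s + (X.submatrix e e).submatrix r id * (P.submatrix e e).submatrix id s := by
    rw [hinv]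
    simp only [Matrix.submatrix_add, Pi.add_apply]
    rw [← Matrix.submatrix_mul_equiv X P e e e, Matrix.submatrix_mul _ _ r id s Function.bijective_id]
  rw [e1]
  refine (norm_add_le _ _).trans (add_le_add le_rfl ?_)
  calc ‖(X.submatrix e e).submatrix r id * (P.submatrix e e).submatrix id s‖
      ≤ ‖(X.submatrix e e).submatrix r id‖ * ‖(P.submatrix e e).submatrix id s‖ := l2_opNorm_mul _ _
    _ ≤ θ / (1 - θ) * ‖(P.submatrix e e).submatrix id s‖ := by
        refine mul_le_mul_of_nonneg_right ?_ (norm_nonneg _)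
        calc ‖(X.submatrix e e).submatrix r id‖ ≤ ‖X.submatrix e e‖ := l2_opNorm_submatrix_rows_le _ hr
          _ = ‖X‖ := l2_opNorm_submatrix_equiv X e e
          _ ≤ θ / (1 - θ) := hX

/-- (BLK) with numeric sups: `‖P′.submatrix r s‖ ≤ pb`, `‖P′.submatrix id s‖ ≤ sb`, `pb + θ∕(1−θ)·sb ≤ t ⟹ ‖(A⁻¹)′.submatrix r s‖ ≤ t`. [folklore] -/
theorem norm_invBlock_le_of_sups {A P : Matrix n n ℂ} {θ : ℝ} (hres : ‖1 - P * A‖ ≤ θ) (hθ1 : θ < 1) (e : v ⊕ w ≃ n)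
    {α β : Type*} [Fintype α] [Fintype β] [DecidableEq α] [DecidableEq β]
    {r : α → v ⊕ w} (hr : Function.Injective r) (s : β → v ⊕ w) {pb sb t : ℝ}
    (hpb : ‖(P.submatrix e e).submatrix r s‖ ≤ pb) (hsb : ‖(P.submatrix e e).submatrix id s‖ ≤ sb) (ht : pb + θ / (1 - θ) * sb ≤ t) :
    ‖((A⁻¹).submatrix e e).submatrix r s‖ ≤ t := by
  have hθ0 : 0 ≤ θ / (1 - θ) := div_nonneg ((norm_nonneg _).trans hres) (by linarith)
  exact (norm_invBlock_le hres hθ1 e hr s).trans ((add_le_add hpb (mul_le_mul_of_nonneg_left hsb hθ0)).trans ht)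

end BLK

section ToBlocks

variable {v w α : Type*}

/-- `toBlocks₁₁` IS the `submatrix` selection `(inl, inl)` (definitional). [folklore] -/
theorem toBlocks₁₁_eq_submatrix (M : Matrix (v ⊕ w) (v ⊕ w) α) : M.toBlocks₁₁ = M.submatrix Sum.inl Sum.inl := rfl
/-- `toBlocks₁₂` IS the `submatrix` selection `(inl, inr)`. [folklore] -/
theorem toBlocks₁₂_eq_submatrix (M : Matrix (v ⊕ w) (v ⊕ w) α) : M.toBlocks₁₂ = M.submatrix Sum.inl Sum.inr := rfl
/-- `toBlocks₂₁` IS the `submatrix` selection `(inr, inl)`. [folklore] -/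
theorem toBlocks₂₁_eq_submatrix (M : Matrix (v ⊕ w) (v ⊕ w) α) : M.toBlocks₂₁ = M.submatrix Sum.inr Sum.inl := rfl
/-- `toBlocks₂₂` IS the `submatrix` selection `(inr, inr)`. [folklore] -/
theorem toBlocks₂₂_eq_submatrix (M : Matrix (v ⊕ w) (v ⊕ w) α) : M.toBlocks₂₂ = M.submatrix Sum.inr Sum.inr := rfl

end ToBlocks

/-! ## §3 The block-currency leaf with `hG` discharged, and the hG-free block leaf from residual data -/

section Leaf

variable {d : ℕ} {n v w : Type*} [Fintype n] [Fintype v] [Fintype w] [DecidableEq n] [DecidableEq v] [DecidableEq w]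

/-- **THE BLOCK-CURRENCY LEAF WITH `hG` DISCHARGED** (cap4's «third representation»): invertibility on the box (from any leg) + sups of the four
blocks of `((A q)⁻¹).submatrix e e` + the norm2x2 criterion ⟹ `‖(A q)⁻¹‖ ≤ B` on the box. [folklore] -/
theorem box_certificate_of_invBlocks {A : (Fin (d + 1) → ℂ) → Matrix n n ℂ} (e : v ⊕ w ≃ n)
    {c : Fin (d + 1) → ℂ} {h : Fin (d + 1) → ℝ} {a b c' e' B : ℝ}
    (hU : ∀ q ∈ Box c h, IsUnit (A q).det)
    (ha : ∀ q ∈ Box c h, ‖(((A q)⁻¹).submatrix e e).toBlocks₁₁‖ ≤ a) (hb : ∀ q ∈ Box c h, ‖(((A q)⁻¹).submatrix e e).toBlocks₁₂‖ ≤ b)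
    (hc : ∀ q ∈ Box c h, ‖(((A q)⁻¹).submatrix e e).toBlocks₂₁‖ ≤ c') (he : ∀ q ∈ Box c h, ‖(((A q)⁻¹).submatrix e e).toBlocks₂₂‖ ≤ e')
    (hB : 0 ≤ B) (hp : a ^ 2 + c' ^ 2 ≤ B ^ 2) (hq₂ : b ^ 2 + e' ^ 2 ≤ B ^ 2)
    (hr : (a * b + c' * e') ^ 2 ≤ (B ^ 2 - (a ^ 2 + c' ^ 2)) * (B ^ 2 - (b ^ 2 + e' ^ 2))) :
    ∀ q ∈ Box c h, IsUnit (A q).det ∧ ‖(A q)⁻¹‖ ≤ B := fun q hq => by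
  refine ⟨hU q hq, ?_⟩
  rw [← l2_opNorm_submatrix_equiv (A q)⁻¹ e e, ← Matrix.fromBlocks_toBlocks (((A q)⁻¹).submatrix e e)]
  exact l2_opNorm_fromBlocks_le _ _ _ _ (ha q hq) (hb q hq) (hc q hq) (he q hq) hB hp hq₂ hr

/-- **THE hG-FREE BLOCK LEAF FROM RESIDUAL DATA** ((BLK) in the kernel).  ENGINE DATA on the box: the residual sup `‖1 − P q·A q‖ ≤ θ < 1`, sups
`p₁₁ p₁₂ p₂₁ p₂₂` of the four blocks of `P′ = (P q).submatrix e e` and `s₁ s₂` of its two column blocks; ARITHMETIC: `a ≥ p₁₁ + θ∕(1−θ)·s₁`,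
`b ≥ p₁₂ + θ∕(1−θ)·s₂`, `c′ ≥ p₂₁ + θ∕(1−θ)·s₁`, `e′ ≥ p₂₂ + θ∕(1−θ)·s₂` and the sqrt-free norm2x2 criterion for `B` ⟹ on the whole box `A q` is
invertible with `‖(A q)⁻¹‖ ≤ B`.  No closed form, no `hG`. [folklore] -/
theorem box_certificate_of_residualBlocks {A P : (Fin (d + 1) → ℂ) → Matrix n n ℂ} (e : v ⊕ w ≃ n)
    {c : Fin (d + 1) → ℂ} {h : Fin (d + 1) → ℝ} {θ p₁₁ p₁₂ p₂₁ p₂₂ s₁ s₂ a b c' e' B : ℝ}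
    (hres : ∀ q ∈ Box c h, ‖1 - P q * A q‖ ≤ θ) (hθ1 : θ < 1)
    (h₁₁ : ∀ q ∈ Box c h, ‖((P q).submatrix e e).toBlocks₁₁‖ ≤ p₁₁) (h₁₂ : ∀ q ∈ Box c h, ‖((P q).submatrix e e).toBlocks₁₂‖ ≤ p₁₂)
    (h₂₁ : ∀ q ∈ Box c h, ‖((P q).submatrix e e).toBlocks₂₁‖ ≤ p₂₁) (h₂₂ : ∀ q ∈ Box c h, ‖((P q).submatrix e e).toBlocks₂₂‖ ≤ p₂₂)
    (hs₁ : ∀ q ∈ Box c h, ‖((P q).submatrix e e).submatrix id Sum.inl‖ ≤ s₁)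
    (hs₂ : ∀ q ∈ Box c h, ‖((P q).submatrix e e).submatrix id Sum.inr‖ ≤ s₂)
    (ha : p₁₁ + θ / (1 - θ) * s₁ ≤ a) (hb : p₁₂ + θ / (1 - θ) * s₂ ≤ b) (hc : p₂₁ + θ / (1 - θ) * s₁ ≤ c')
    (he : p₂₂ + θ / (1 - θ) * s₂ ≤ e') (hB : 0 ≤ B) (hp : a ^ 2 + c' ^ 2 ≤ B ^ 2) (hq₂ : b ^ 2 + e' ^ 2 ≤ B ^ 2)
    (hr : (a * b + c' * e') ^ 2 ≤ (B ^ 2 - (a ^ 2 + c' ^ 2)) * (B ^ 2 - (b ^ 2 + e' ^ 2))) :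
    ∀ q ∈ Box c h, IsUnit (A q).det ∧ ‖(A q)⁻¹‖ ≤ B := by
  refine box_certificate_of_invBlocks e (fun q hq => (krawczyk (hres q hq) hθ1).1)
    (fun q hq => ?_) (fun q hq => ?_) (fun q hq => ?_) (fun q hq => ?_) hB hp hq₂ hr
  · have h := h₁₁ q hq; rw [toBlocks₁₁_eq_submatrix] at h ⊢
    exact norm_invBlock_le_of_sups (hres q hq) hθ1 e Sum.inl_injective Sum.inl h (hs₁ q hq) ha
  · have h := h₁₂ q hq; rw [toBlocks₁₂_eq_submatrix] at h ⊢
    exact norm_invBlock_le_of_sups (hres q hq) hθ1 e Sum.inl_injective Sum.inr h (hs₂ q hq) hb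
  · have h := h₂₁ q hq; rw [toBlocks₂₁_eq_submatrix] at h ⊢
    exact norm_invBlock_le_of_sups (hres q hq) hθ1 e Sum.inr_injective Sum.inl h (hs₁ q hq) hc
  · have h := h₂₂ q hq; rw [toBlocks₂₂_eq_submatrix] at h ⊢
    exact norm_invBlock_le_of_sups (hres q hq) hθ1 e Sum.inr_injective Sum.inr h (hs₂ q hq) he

/-- the crude variant: both column sups replaced by a sup `p ≥ ‖P q‖` of the whole preconditioner. [folklore] -/
theorem box_certificate_of_residualBlocks' {A P : (Fin (d + 1) → ℂ) → Matrix n n ℂ} (e : v ⊕ w ≃ n)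
    {c : Fin (d + 1) → ℂ} {h : Fin (d + 1) → ℝ} {θ p p₁₁ p₁₂ p₂₁ p₂₂ a b c' e' B : ℝ}
    (hres : ∀ q ∈ Box c h, ‖1 - P q * A q‖ ≤ θ) (hθ1 : θ < 1) (hP : ∀ q ∈ Box c h, ‖P q‖ ≤ p)
    (h₁₁ : ∀ q ∈ Box c h, ‖((P q).submatrix e e).toBlocks₁₁‖ ≤ p₁₁) (h₁₂ : ∀ q ∈ Box c h, ‖((P q).submatrix e e).toBlocks₁₂‖ ≤ p₁₂)
    (h₂₁ : ∀ q ∈ Box c h, ‖((P q).submatrix e e).toBlocks₂₁‖ ≤ p₂₁) (h₂₂ : ∀ q ∈ Box c h, ‖((P q).submatrix e e).toBlocks₂₂‖ ≤ p₂₂)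
    (ha : p₁₁ + θ / (1 - θ) * p ≤ a) (hb : p₁₂ + θ / (1 - θ) * p ≤ b) (hc : p₂₁ + θ / (1 - θ) * p ≤ c')
    (he : p₂₂ + θ / (1 - θ) * p ≤ e') (hB : 0 ≤ B) (hp : a ^ 2 + c' ^ 2 ≤ B ^ 2) (hq₂ : b ^ 2 + e' ^ 2 ≤ B ^ 2)
    (hr : (a * b + c' * e') ^ 2 ≤ (B ^ 2 - (a ^ 2 + c' ^ 2)) * (B ^ 2 - (b ^ 2 + e' ^ 2))) :
    ∀ q ∈ Box c h, IsUnit (A q).det ∧ ‖(A q)⁻¹‖ ≤ B := by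
  have hPe : ∀ q ∈ Box c h, ‖(P q).submatrix e e‖ ≤ p := fun q hq => (l2_opNorm_submatrix_equiv _ e e).le.trans (hP q hq)
  have hcol₁ : ∀ q ∈ Box c h, ‖((P q).submatrix e e).submatrix id Sum.inl‖ ≤ p := fun q hq =>
    (l2_opNorm_submatrix_cols_le _ Sum.inl_injective).trans (hPe q hq)
  have hcol₂ : ∀ q ∈ Box c h, ‖((P q).submatrix e e).submatrix id Sum.inr‖ ≤ p := fun q hq =>
    (l2_opNorm_submatrix_cols_le _ Sum.inr_injective).trans (hPe q hq)
  exact box_certificate_of_residualBlocks e hres hθ1 h₁₁ h₁₂ h₂₁ h₂₂ hcol₁ hcol₂ ha hb hc he hB hp hq₂ hr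

end Leaf

end

end Summit.QuantumFields.BalabanUV.Beta.ResolventBoxCertificate

/-! ## §4 The residual-block leaf record over `ℚ` -/

namespace Summit.QuantumFields.BalabanUV.Beta.ResolventResidualBlocks

open Complex Set Matrix Finset
open Summit.QuantumFields.BalabanUV.Beta.ResolventBoxCertificate
open scoped Real Matrix.Norms.L2Operator

noncomputable section

variable {d : ℕ}

/-- **THE RESIDUAL-BLOCK LEAF RECORD** (engine D's DBLOCK leaf, cap4-g19 l.19578 ∕ `box_certificate_of_residualBlocks`' numeric content): a box
`(cRe, cIm, h)`, the residual sup `θ`, the four block sups `p₁₁ p₁₂ p₂₁ p₂₂` and the two column sups `s₁ s₂` of the reindexed preconditioner, the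
budget `B` — exact rationals. [folklore] -/
structure ResidualBlockLeafRecord (d : ℕ) where
  /-- real parts of the box centre. -/
  cRe : Fin (d + 1) → ℚ
  /-- imaginary parts of the box centre (the sign-class torus). -/
  cIm : Fin (d + 1) → ℚ
  /-- half-widths of the box. -/
  h : Fin (d + 1) → ℚ
  /-- `θ ≥ sup_box ‖1 − P q · A q‖`. -/
  θ : ℚ
  /-- `p₁₁ ≥ sup_box ‖P′₁₁‖`, `P′ = (P q).submatrix e e`. -/
  p₁₁ : ℚ
  /-- `p₁₂ ≥ sup_box ‖P′₁₂‖`. -/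
  p₁₂ : ℚ
  /-- `p₂₁ ≥ sup_box ‖P′₂₁‖`. -/
  p₂₁ : ℚ
  /-- `p₂₂ ≥ sup_box ‖P′₂₂‖`. -/
  p₂₂ : ℚ
  /-- `s₁ ≥ sup_box ‖P′.submatrix id inl‖` (first column block). -/
  s₁ : ℚ
  /-- `s₂ ≥ sup_box ‖P′.submatrix id inr‖` (second column block). -/
  s₂ : ℚ
  /-- the budget: the record claims `‖(A q)⁻¹‖ ≤ B` on the box. -/
  B : ℚ

namespace ResidualBlockLeafRecord

variable (r : ResidualBlockLeafRecord d)

/-- the complex box centre. [folklore] -/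
def ctr : Fin (d + 1) → ℂ := fun μ => (((r.cRe μ : ℚ) : ℝ) : ℂ) + (((r.cIm μ : ℚ) : ℝ) : ℂ) * I
/-- the real half-widths. [folklore] -/
def hw : Fin (d + 1) → ℝ := fun μ => ((r.h μ : ℚ) : ℝ)
/-- the record's box. [folklore] -/
def box : Set (Fin (d + 1) → ℂ) := Box r.ctr r.hw
/-- the Neumann factor `θ∕(1−θ)`. [folklore] -/
def t : ℚ := r.θ / (1 - r.θ)
/-- the derived bound `a = p₁₁ + θ∕(1−θ)·s₁` of the `vv` block of the inverse. [folklore] -/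
def a : ℚ := r.p₁₁ + r.t * r.s₁
/-- the derived bound `b = p₁₂ + θ∕(1−θ)·s₂` of the `vw` block. [folklore] -/
def b : ℚ := r.p₁₂ + r.t * r.s₂
/-- the derived bound `c′ = p₂₁ + θ∕(1−θ)·s₁` of the `wv` block. [folklore] -/
def c' : ℚ := r.p₂₁ + r.t * r.s₁
/-- the derived bound `e′ = p₂₂ + θ∕(1−θ)·s₂` of the `ww` block. [folklore] -/
def e' : ℚ := r.p₂₂ + r.t * r.s₂

/-- **VALIDITY** = `θ < 1 ∧ 0 ≤ B ∧` the sqrt-free norm2x2 criterion on the derived `a b c′ e′` — exact rationals. [folklore] -/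
def Valid : Prop :=
  r.θ < 1 ∧ 0 ≤ r.B ∧ r.a ^ 2 + r.c' ^ 2 ≤ r.B ^ 2 ∧ r.b ^ 2 + r.e' ^ 2 ≤ r.B ^ 2 ∧
    (r.a * r.b + r.c' * r.e') ^ 2 ≤ (r.B ^ 2 - (r.a ^ 2 + r.c' ^ 2)) * (r.B ^ 2 - (r.b ^ 2 + r.e' ^ 2))

/-- validity is DECIDABLE (`decide +kernel` ∕ `norm_num` after unfolding; plain `decide` does not reduce `Rat` arithmetic). [folklore] -/
instance decidableValid : Decidable r.Valid := by unfold Valid; infer_instance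

variable {n v w : Type*} [Fintype n] [Fintype v] [Fintype w] [DecidableEq n] [DecidableEq v] [DecidableEq w]

/-- **A VALID RESIDUAL-BLOCK RECORD CERTIFIES ITS BOX — NO CLOSED FORM, NO `hG`**: validity + the residual sup + the six P-block sups ⟹ `A q`
invertible and `‖(A q)⁻¹‖ ≤ B` on the whole box. [folklore] -/
theorem certifies (hv : r.Valid) {A P : (Fin (d + 1) → ℂ) → Matrix n n ℂ} (e : v ⊕ w ≃ n)
    (hres : ∀ q ∈ r.box, ‖1 - P q * A q‖ ≤ r.θ)
    (h₁₁ : ∀ q ∈ r.box, ‖((P q).submatrix e e).toBlocks₁₁‖ ≤ r.p₁₁) (h₁₂ : ∀ q ∈ r.box, ‖((P q).submatrix e e).toBlocks₁₂‖ ≤ r.p₁₂)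
    (h₂₁ : ∀ q ∈ r.box, ‖((P q).submatrix e e).toBlocks₂₁‖ ≤ r.p₂₁) (h₂₂ : ∀ q ∈ r.box, ‖((P q).submatrix e e).toBlocks₂₂‖ ≤ r.p₂₂)
    (hs₁ : ∀ q ∈ r.box, ‖((P q).submatrix e e).submatrix id Sum.inl‖ ≤ r.s₁)
    (hs₂ : ∀ q ∈ r.box, ‖((P q).submatrix e e).submatrix id Sum.inr‖ ≤ r.s₂) :
    ∀ q ∈ r.box, IsUnit (A q).det ∧ ‖(A q)⁻¹‖ ≤ r.B := by
  obtain ⟨hθ1, hB, hp, hq, hr⟩ := hv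
  have hθ1' : (r.θ : ℝ) < 1 := by exact_mod_cast hθ1
  have ht : ((r.t : ℚ) : ℝ) = (r.θ : ℝ) / (1 - r.θ) := by simp [t]
  refine box_certificate_of_residualBlocks e hres hθ1' h₁₁ h₁₂ h₂₁ h₂₂ hs₁ hs₂
    (a := r.a) (b := r.b) (c' := r.c') (e' := r.e') (B := r.B) ?_ ?_ ?_ ?_ ?_ ?_ ?_ ?_
  · rw [← ht]; exact_mod_cast (le_refl r.a)
  · rw [← ht]; exact_mod_cast (le_refl r.b)
  · rw [← ht]; exact_mod_cast (le_refl r.c')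
  · rw [← ht]; exact_mod_cast (le_refl r.e')
  · exact_mod_cast hB
  · exact_mod_cast hp
  · exact_mod_cast hq
  · exact_mod_cast hr

/-- with a uniform budget. [folklore] -/
theorem certifies_le (hv : r.Valid) {Ba : ℝ} (hBa : (r.B : ℝ) ≤ Ba) {A P : (Fin (d + 1) → ℂ) → Matrix n n ℂ} (e : v ⊕ w ≃ n)
    (hres : ∀ q ∈ r.box, ‖1 - P q * A q‖ ≤ r.θ)
    (h₁₁ : ∀ q ∈ r.box, ‖((P q).submatrix e e).toBlocks₁₁‖ ≤ r.p₁₁) (h₁₂ : ∀ q ∈ r.box, ‖((P q).submatrix e e).toBlocks₁₂‖ ≤ r.p₁₂)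
    (h₂₁ : ∀ q ∈ r.box, ‖((P q).submatrix e e).toBlocks₂₁‖ ≤ r.p₂₁) (h₂₂ : ∀ q ∈ r.box, ‖((P q).submatrix e e).toBlocks₂₂‖ ≤ r.p₂₂)
    (hs₁ : ∀ q ∈ r.box, ‖((P q).submatrix e e).submatrix id Sum.inl‖ ≤ r.s₁)
    (hs₂ : ∀ q ∈ r.box, ‖((P q).submatrix e e).submatrix id Sum.inr‖ ≤ r.s₂) :
    ∀ q ∈ r.box, IsUnit (A q).det ∧ ‖(A q)⁻¹‖ ≤ Ba := fun q hq =>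
  let h := r.certifies hv e hres h₁₁ h₁₂ h₂₁ h₂₂ hs₁ hs₂ q hq
  ⟨h.1, h.2.trans hBa⟩

end ResidualBlockLeafRecord

/-- ARITHMETIC DEMO (illustrative rationals of the SIZE cap4-g19 forecasts — `θ = 7∕1000`, block sups `65, 62, 55, 345`, column sups `85, 350`,
`B = 420` — NOT an engine record, NOT a certificate): the kernel DECIDES validity of the derived-block criterion. [folklore] -/
example : (⟨fun _ => 3217 / 1024, fun _ => 9 / 10, fun _ => 1 / 16, 7 / 1000, 65, 62, 55, 345, 85, 350, 420⟩ :
    ResidualBlockLeafRecord 3).Valid := by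
  simp only [ResidualBlockLeafRecord.Valid, ResidualBlockLeafRecord.a, ResidualBlockLeafRecord.b, ResidualBlockLeafRecord.c',
    ResidualBlockLeafRecord.e', ResidualBlockLeafRecord.t]; norm_num

/-- … and refutes it at `B = 350` (`t = 7∕993`; the second column `b = 62 + t·350 ≈ 64.47`, `e′ = 345 + t·350 ≈ 347.47` has `b² + e′² ≈ 124 890 > 350²`;
v1.0.1 DOCFIX of the gloss, XREAD C-ne9leaf04g30-1). [folklore] -/
example : ¬ (⟨fun _ => 3217 / 1024, fun _ => 9 / 10, fun _ => 1 / 16, 7 / 1000, 65, 62, 55, 345, 85, 350, 350⟩ :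
    ResidualBlockLeafRecord 3).Valid := by
  simp only [ResidualBlockLeafRecord.Valid, ResidualBlockLeafRecord.a, ResidualBlockLeafRecord.b, ResidualBlockLeafRecord.c',
    ResidualBlockLeafRecord.e', ResidualBlockLeafRecord.t]; norm_num

/-! ## §5 `hcert` from residual-block records -/

section Records

variable {n v w : Type*} [Fintype n] [Fintype v] [Fintype w] [DecidableEq n] [DecidableEq v] [DecidableEq w]

/-- **`hcert` FROM RESIDUAL-BLOCK RECORDS**: one record per box of a list, each valid with budget `≤ Ba`, each box inside its record's box, and per
record a preconditioner family with the residual sup and the six P-block sups ⟹ the binder `hcert` of every route-A anchor (e.g.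
`ResolventLeafRecord.rowsOfOneLoopFormCode16E_routeA₂_ofSchedulesQ`) — NO closed form, NO `hG`. [folklore] -/
theorem hcert_of_residualBlockRecords {boxes : Finset ((Fin (d + 1) → ℂ) × (Fin (d + 1) → ℝ))}
    (rec : (Fin (d + 1) → ℂ) × (Fin (d + 1) → ℝ) → ResidualBlockLeafRecord d) {Ba : ℝ}
    (hvalid : ∀ bx ∈ boxes, (rec bx).Valid ∧ ((rec bx).B : ℝ) ≤ Ba)
    (hsub : ∀ bx ∈ boxes, Box bx.1 bx.2 ⊆ (rec bx).box)
    {A : (Fin (d + 1) → ℂ) → Matrix n n ℂ} (e : v ⊕ w ≃ n)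
    (P : (Fin (d + 1) → ℂ) × (Fin (d + 1) → ℝ) → (Fin (d + 1) → ℂ) → Matrix n n ℂ)
    (hres : ∀ bx ∈ boxes, ∀ q ∈ (rec bx).box, ‖1 - P bx q * A q‖ ≤ (rec bx).θ)
    (h₁₁ : ∀ bx ∈ boxes, ∀ q ∈ (rec bx).box, ‖((P bx q).submatrix e e).toBlocks₁₁‖ ≤ (rec bx).p₁₁)
    (h₁₂ : ∀ bx ∈ boxes, ∀ q ∈ (rec bx).box, ‖((P bx q).submatrix e e).toBlocks₁₂‖ ≤ (rec bx).p₁₂)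
    (h₂₁ : ∀ bx ∈ boxes, ∀ q ∈ (rec bx).box, ‖((P bx q).submatrix e e).toBlocks₂₁‖ ≤ (rec bx).p₂₁)
    (h₂₂ : ∀ bx ∈ boxes, ∀ q ∈ (rec bx).box, ‖((P bx q).submatrix e e).toBlocks₂₂‖ ≤ (rec bx).p₂₂)
    (hs₁ : ∀ bx ∈ boxes, ∀ q ∈ (rec bx).box, ‖((P bx q).submatrix e e).submatrix id Sum.inl‖ ≤ (rec bx).s₁)
    (hs₂ : ∀ bx ∈ boxes, ∀ q ∈ (rec bx).box, ‖((P bx q).submatrix e e).submatrix id Sum.inr‖ ≤ (rec bx).s₂) :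
    ∀ bx ∈ boxes, ∀ q ∈ Box bx.1 bx.2, IsUnit (A q).det ∧ ‖(A q)⁻¹‖ ≤ Ba := fun bx hbx q hq =>
  (rec bx).certifies_le (hvalid bx hbx).1 (hvalid bx hbx).2 e (hres bx hbx) (h₁₁ bx hbx) (h₁₂ bx hbx) (h₂₁ bx hbx) (h₂₂ bx hbx)
    (hs₁ bx hbx) (hs₂ bx hbx) q (hsub bx hbx hq)

end Records

end

end Summit.QuantumFields.BalabanUV.Beta.ResolventResidualBlocks
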